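import Summits.QuantumFields.BalabanUV.Beta.SecondOrderStepLaw

/-!
# `BalabanUV.Beta.SecondOrderZeroLaw` — binder row D1, (L4) piece (W-E): **THE LEVEL-GENERIC ASSEMBLY WITH AN ARBITRARY FIELD-SUPPORTED SECTOR**
# (`quarticZero_bref_of_laws`) — in particular THE LEVEL-`0` SOCKET SPLIT of the second-order letter of the recursive wall literal into the Wilson
# letter (field sector) and the border letter (β sub-cell, row BETA-an2 = BINDER-OWNERS row D1 OWNER, lineage an2 gen 18)

HONEST FRAMING (cell charter, verbatim): «discharging BetaPertH makes Balaban's UV stability UNCONDITIONAL — a real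
constructive-QFT result; it is NOT the continuum limit and NOT the Clay problem.»  Neutral kernel algebra ([folklore]), entrywise by fibre
blocks; no statement of Bałaban's papers, no `[cite:]`, no `def`, no `Prop` fact; instantiates no binder of the wall.  NOT D1, NOT `BetaPertH`,
NOT continuum, NOT Clay.

WHAT: `SecondOrderStepLaw.quarticStep_bref_of_laws` took its field sector, field letters and field-block kernel as `mm`-reads (automatically
supported on the field block).  Here they are ARBITRARY kernels with field support as hypotheses — so the SAME assembly serves the level `0` of
the induction (`SpineRecursiveT2All.T2RecAt_bref_all_of_letters`'s hypothesis `h0`): `T2RecAt 0 = cE₂ • wilsonW₂ 3 T + cB • vh₂S`, with `Q :=`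
the Wilson (2,2) bi-stencil (an3-g32 W-0W-S2/S3, leaf-09-g4's table law), `E := wilsonA`, `P :=` the field block of `bhKAt` (`w = 1`), `B := vh₂S`
(an1's border letter at level 0), `aE := cE = Lc⁴`, `a := cE₂`, `Vbd := cVH • vhSAt ρ_c`.  The LOCKS in solved form read `γ₀ = cE·κ_W`
(`κ_W` = the Wilson letter's first-order contact coefficient: with `γ₀ = cVH/Lc⁴ = −cE/2` this is an3's `−½`) and `cE₂ = cE²` (= (W-L-2) at `j = 0`).
Provenance: β sub-cell, unit beta-an2 gen 18, 2026-08-20 (v1); no existing file touched.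
-/

open Finset
open scoped BigOperators
open Literature.MathematicalPhysics.QuantumFieldTheory.Balaban1983to89
open Literature.MathematicalPhysics.QuantumFieldTheory.Balaban1983to89.Beta
open ExpKernelCalculus (MKer)
open PolarizationSign (reflSign)
open KernelReflection (refK refK_apply)
open ResolventReflection (bref Φ)
open OneStepResolventKernel (Fib)
open Summit.QuantumFields.BalabanUV.Beta.ChartConjugation (conjV conjW conjW₁ conjW₂)
open Summit.QuantumFields.BalabanUV.Beta.BorderedHessian (diagK ctGen conjV_diagK_apply)
open Summit.QuantumFields.BalabanUV.Beta.SecondOrderStepLaw (conjW_diag_apply)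

namespace Summit.QuantumFields.BalabanUV.Beta.SecondOrderZeroLaw

noncomputable section

variable {d : ℕ}

section Zero

variable {L : ℕ} {𝕄 P : MKer (d + 1) (Fib d)} {w a aE b κ₁ γ' : ℝ} {α : Fin (d + 1)}
  {Q R₀ B RB : Fin (d + 1) → (Fin (d + 1) → ℤ) → Fin (d + 1) → (Fin (d + 1) → ℤ) → MKer (d + 1) (Fib d)}
  {E Vbd : Fin (d + 1) → (Fin (d + 1) → ℤ) → MKer (d + 1) (Fib d)}
  {hh hB : Fin (d + 1) → (Fin (d + 1) → ℤ) → Fin (d + 1) → (Fin (d + 1) → ℤ) → (Fin (d + 1) → ℤ) → Fib d → ℝ}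

/-- [folklore] **THE LEVEL-GENERIC ASSEMBLY WITH AN ARBITRARY FIELD-SUPPORTED SECTOR** — `SecondOrderStepLaw.quarticStep_bref_of_laws` with the
`mm`-reads replaced by arbitrary kernels supported on the field block (`P` with `𝕄 =ff= w·P`, the field sector `Q`, the field letters `E`, the
transported remainder `R₀`; hypotheses `hP*`/`hQ*`/`hE*`/`hR*` = their vanishing off the field block).  READING: the LEVEL-`0` assembly of the
second-order letter of the recursive wall literal (`T2RecAt 0 = cE₂ • wilsonW₂ 3 T + cB • vh₂S`: `Q :=` the Wilson (2,2) bi-stencil with an3/leaf-09's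
letter, `E := wilsonA`, `P :=` the Wilson Hessian, `𝕄 := bhKAt`, `B := vh₂S` with an1's border letter, `aE := cE`, `a := cE₂`; locks `γ₀ = cE·κ_W/w`,
`cE₂ = cE²/w` — with `2·cVH = −cE·Lc⁴` the Wilson letter's contact coefficient is pinned to `κ_W = w·γ₀/cE = −w/2`, an3's «−½ at order (2,1)»). -/
theorem quarticZero_bref_of_laws (hw : w ≠ 0) (hγ' : γ' = aE * κ₁ / w) (ha : a = aE ^ 2 / w)
    (hff : ∀ (x z : Fin (d + 1) → ℤ) (β β' : Fin (d + 1)), 𝕄 x z (Sum.inl β) (Sum.inl β') = w * P x z (Sum.inl β) (Sum.inl β'))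
    (hPl : ∀ (x z : Fin (d + 1) → ℤ) (m : Fin (d + 1)) (b' : Fib d), P x z (Sum.inr m) b' = 0)
    (hPr : ∀ (x z : Fin (d + 1) → ℤ) (a' : Fib d) (m : Fin (d + 1)), P x z a' (Sum.inr m) = 0)
    (hQl : ∀ κ u κ' u' (x z : Fin (d + 1) → ℤ) (m : Fin (d + 1)) (b' : Fib d), Q κ u κ' u' x z (Sum.inr m) b' = 0)
    (hQr : ∀ κ u κ' u' (x z : Fin (d + 1) → ℤ) (a' : Fib d) (m : Fin (d + 1)), Q κ u κ' u' x z a' (Sum.inr m) = 0)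
    (hEl : ∀ κ u (x z : Fin (d + 1) → ℤ) (m : Fin (d + 1)) (b' : Fib d), E κ u x z (Sum.inr m) b' = 0)
    (hEr : ∀ κ u (x z : Fin (d + 1) → ℤ) (a' : Fib d) (m : Fin (d + 1)), E κ u x z a' (Sum.inr m) = 0)
    (hRl : ∀ κ u κ' u' (x z : Fin (d + 1) → ℤ) (m : Fin (d + 1)) (b' : Fib d), R₀ κ u κ' u' x z (Sum.inr m) b' = 0)
    (hRr : ∀ κ u κ' u' (x z : Fin (d + 1) → ℤ) (a' : Fib d) (m : Fin (d + 1)), R₀ κ u κ' u' x z a' (Sum.inr m) = 0)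
    (hBff : ∀ κ u κ' u' (x z : Fin (d + 1) → ℤ) (β β' : Fin (d + 1)), B κ u κ' u' x z (Sum.inl β) (Sum.inl β') = 0)
    (hRBff : ∀ κ u κ' u' (x z : Fin (d + 1) → ℤ) (β β' : Fin (d + 1)), RB κ u κ' u' x z (Sum.inl β) (Sum.inl β') = 0)
    (hVff : ∀ κ u (x z : Fin (d + 1) → ℤ) (β β' : Fin (d + 1)), Vbd κ u x z (Sum.inl β) (Sum.inl β') = 0)
    (hQ : ∀ κ u κ' u', Q κ (bref α κ u) κ' (bref α κ' u') = (reflSign α κ * reflSign α κ') • refK (Φ (d := d) L α)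
      (Q κ u κ' u' +
        conjW (P) (E κ u) (E κ' u') (diagK fun p c => κ₁ * ctGen d α L κ u p c)
          (diagK fun p c => κ₁ * ctGen d α L κ' u' p c) (diagK (hh κ u κ' u')) - R₀ κ u κ' u'))
    (hBfm : ∀ κ u κ' u' (x z : Fin (d + 1) → ℤ) (β m : Fin (d + 1)),
      (b • B κ (bref α κ u) κ' (bref α κ' u')) x z (Sum.inl β) (Sum.inr m) =
        ((reflSign α κ * reflSign α κ') • refK (Φ (d := d) L α) (b • B κ u κ' u' +
          conjW 𝕄 (aE • E κ u + Vbd κ u) (aE • E κ' u' + Vbd κ' u') (diagK fun p c => γ' * ctGen d α L κ u p c)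
            (diagK fun p c => γ' * ctGen d α L κ' u' p c) (diagK (hB κ u κ' u')) + RB κ u κ' u')) x z (Sum.inl β) (Sum.inr m))
    (hBmf : ∀ κ u κ' u' (x z : Fin (d + 1) → ℤ) (m β : Fin (d + 1)),
      (b • B κ (bref α κ u) κ' (bref α κ' u')) x z (Sum.inr m) (Sum.inl β) =
        ((reflSign α κ * reflSign α κ') • refK (Φ (d := d) L α) (b • B κ u κ' u' +
          conjW 𝕄 (aE • E κ u + Vbd κ u) (aE • E κ' u' + Vbd κ' u') (diagK fun p c => γ' * ctGen d α L κ u p c)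
            (diagK fun p c => γ' * ctGen d α L κ' u' p c) (diagK (hB κ u κ' u')) + RB κ u κ' u')) x z (Sum.inr m) (Sum.inl β))
    (hBmm : ∀ κ u κ' u' (x z : Fin (d + 1) → ℤ) (m m' : Fin (d + 1)),
      (b • B κ (bref α κ u) κ' (bref α κ' u')) x z (Sum.inr m) (Sum.inr m') =
        ((reflSign α κ * reflSign α κ') • refK (Φ (d := d) L α) (b • B κ u κ' u' +
          conjW 𝕄 (aE • E κ u + Vbd κ u) (aE • E κ' u' + Vbd κ' u') (diagK fun p c => γ' * ctGen d α L κ u p c)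
            (diagK fun p c => γ' * ctGen d α L κ' u' p c) (diagK (hB κ u κ' u')) + RB κ u κ' u')) x z (Sum.inr m) (Sum.inr m'))
    (κ : Fin (d + 1)) (u : Fin (d + 1) → ℤ) (κ' : Fin (d + 1)) (u' : Fin (d + 1) → ℤ) :
    a • Q κ (bref α κ u) κ' (bref α κ' u') + b • B κ (bref α κ u) κ' (bref α κ' u') =
      (reflSign α κ * reflSign α κ') • refK (Φ (d := d) L α)
        ((a • Q κ u κ' u' + b • B κ u κ' u') +
          conjW 𝕄 (aE • E κ u + Vbd κ u) (aE • E κ' u' + Vbd κ' u') (diagK fun p c => γ' * ctGen d α L κ u p c)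
            (diagK fun p c => γ' * ctGen d α L κ' u' p c) (diagK (hB κ u κ' u')) +
          (-(a • R₀ κ u κ' u') + RB κ u κ' u' +
            conjV (P) (diagK fun p c => a * hh κ u κ' u' p c - w * hB κ u κ' u' p c))) := by
  subst hγ' ha
  funext x z e f
  rcases e with β | m <;> rcases f with β' | m'
  · -- field–field: the `Q` sector carries the contact; the border sector, `Vbd` and `RB` vanish; the locks match the coefficients
    have hq := congrFun (congrFun (congrFun (congrFun (hQ κ u κ' u') x) z) (Sum.inl β)) (Sum.inl β')
    simp only [Pi.add_apply, Pi.sub_apply, Pi.neg_apply, Pi.smul_apply, smul_eq_mul, refK_apply, conjW_diag_apply, conjV_diagK_apply,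
      hBff, hRBff, hVff, hff] at hq ⊢
    rw [hq]
    field_simp
    ring
  · -- field–multiplier: the border letter; `Q`, `R₀`, `P` vanish
    have hb := hBfm κ u κ' u' x z β m'
    simp only [Pi.add_apply, Pi.neg_apply, Pi.smul_apply, smul_eq_mul, refK_apply, conjW_diag_apply, conjV_diagK_apply,
      hPr, hQr, hEr, hRr, mul_zero, zero_mul, add_zero, zero_add, neg_zero] at hb ⊢
    rw [hb]
  · have hb := hBmf κ u κ' u' x z m β'
    simp only [Pi.add_apply, Pi.neg_apply, Pi.smul_apply, smul_eq_mul, refK_apply, conjW_diag_apply, conjV_diagK_apply,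
      hPl, hQl, hEl, hRl, mul_zero, zero_mul, add_zero, zero_add, neg_zero] at hb ⊢
    rw [hb]
  · have hb := hBmm κ u κ' u' x z m m'
    simp only [Pi.add_apply, Pi.neg_apply, Pi.smul_apply, smul_eq_mul, refK_apply, conjW_diag_apply, conjV_diagK_apply,
      hPl, hQl, hEl, hRl, mul_zero, zero_mul, add_zero, zero_add, neg_zero] at hb ⊢
    rw [hb]

end Zero

end

end Summit.QuantumFields.BalabanUV.Beta.SecondOrderZeroLaw
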